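import Literature.Claims.NS.Wu2026
import Literature.Analysis.FluidPDE.WholeSpaceDivCurlIdentity
import HarnessLib

/-!
# C177 `Wu2026` — TRUE column: `Step_33`, the whole-space div–curl identity (3.3), HOLDS

D-0090 NS-CLAIMS sweep, claim C177 (W. Wu, arXiv:2608.22471v1), skeleton
`Literature/Claims/NS/Wu2026.lean` (typist-10 g6; rev 2 p560520). The consumed binder `h33` of
`Literature.Claims.NS.Wu2026.claim_of_steps''` is the printed step (3.3) p.7 l.20–26: «Since v is
divergence-free and ∇v ∈ L², the standard whole-space div–curl identity [8] gives
‖ω‖²_{L²(R³)} = D.» This file proves it EXACTLY AS TYPED (`Step_33`), as a one-line instance of the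
Literature theorem `Literature.Analysis.FluidPDE.lintegral_norm_curl_sq_eq_lintegral_frobeniusNormSq`
(`Literature/Analysis/FluidPDE/WholeSpaceDivCurlIdentity.lean`: for a smooth divergence-free field
tending to `0` at infinity with `∫|∇v|² < ∞`, `∫|curl v|² = ∫|∇v|²`; physical-space proof via the
pointwise identity `|∇v|² − |curl v|² = div((v·∇)v)`, cut-off integration by parts, and Hardy's
inequality for fields vanishing at infinity,
`Literature.Analysis.Calculus.hardy_sq_lintegral_exterior_le_of_tendsto_cocompact`). Only the
fields `smooth_v`, `profile.divFree` and `decay` of `IsWuFlow` are used (the vorticity hypothesis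
(1.4) and the equation are not needed for (3.3)).

Records, not a verdict: the row's verdict vocabulary and door are the chair's (RULINGS v1.51 (1));
this is a TRUE-column kernel object («salvage-p1 g5», DECONFLICT with salvage-p3 g6 19:23:35Z).

WHAT THIS IS NOT: not a claim about NS regularity or blow-up; not a claim about any author beyond
the typed locator.
-/

noncomputable section

set_option linter.dupNamespace false

namespace Summit.NavierStokesRegularity.NavierStokesRegularity.Theorems.Wu2026Salvage

open Literature.Analysis.FluidPDE Literature.Claims.NS.Wu2026

/-- **`Step_33` holds** ((3.3) p.7 l.20–26 «the standard whole-space div–curl identity [8] gives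
‖ω‖²_{L²(R³)} = D»): for every `IsWuFlow ν v p` with `D(v) < ∞`, `∫ |curl v|² = D(v)` — by
`Literature.Analysis.FluidPDE.lintegral_norm_curl_sq_eq_lintegral_frobeniusNormSq` applied to the
smooth, divergence-free, decaying field `v`. [cite: Wu2026, (3.3) p.7 l.20–26] -/
theorem step_33 : Literature.Claims.NS.Wu2026.Step_33 := by
  intro ν _hν v _p hf hD
  exact lintegral_norm_curl_sq_eq_lintegral_frobeniusNormSq hf.smooth_v hf.profile.divFree
    hf.decay hD

end Summit.NavierStokesRegularity.NavierStokesRegularity.Theorems.Wu2026Salvage
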